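import Summits.Parity.GeneralizedHardyLittlewood.Theses.PrimeLevelFamEdge
import Literature.NumberTheory.LFunctions.KMVMomentsToHalfEdgePB

/-!
# Route `PrimeLevelFamEdge`, aside item `EdgeOfBeyondDiagonalValue` (stmt-Parity-20436, R2-G44 re-thread of stmt-Parity-20008) — holds

Rev 2 of this file (route rev 7, d9f269e52d7f, 2026-08-27). The route's CONVERSION statement, re-threaded
over the REPAIRED Petersson bound: under the two printed facts, in this order — Lapid–Rallis / Kohnen–Zagier
non-negativity `IwaniecSarnak.lapidRallis2003_theorem1_gl2Twist` (route item `TwistNonneg`) and the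
Kowalski–Michel Petersson BOUND in gcd form `KowalskiMichel2000.kowalskiMichel2000_peterssonBound` (route item
`PeterssonBoundPrinted`, stmt-Parity-20404; the all-indices formula `kowalskiMichel2000_petersson` named by
rev 1 of this file is refuted AS TYPED, `KowalskiMichelAllIndices.not_kowalskiMichel2000_petersson`, and is no
longer a route obligation) — KMV mollified first/second harmonic moment asymptotics on a length window
`(1, Δ]` BEYOND the diagonal with main terms `lin + T₁`, `second + T₂` (`KMV2000.MomentAsymptotics 1 Δ T₁ T₂`),
together with an admissible profile `P` whose Cauchy–Schwarz value `(lin + T₁)² / (2 (second + T₂))` exceeds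
`1/4` at every length of an initial segment `(1, b)` of the window, give the weight-2 prime-level fam edge
`FamEdgeWeightTwo = ∃ p₁ > 1/2, CentralValueFamilyHalfEdge.primeLevelFamilyTwo.EStarFam p₁ 2`.

This is, verbatim, the tree theorem
`Literature.NumberTheory.LFunctions.CentralValueFamilyHalfEdge.primeLevelFamilyTwo_EStarFam_of_beyondDiagonalValue_pb`
(`Literature/NumberTheory/LFunctions/KMVMomentsToHalfEdgePB.lean`, p533413, ls-rescue-typ-1 g2 — the
`_pb` twin of `primeLevelFamilyTwo_EStarFam_of_beyondDiagonalValue`, p484308), so the item closes by `exact`.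

WHAT THIS IS NOT: no crux is touched — `MomentsBeyondDiagonal` (the second moment beyond the diagonal
at an individual prime level, OPEN IN PRINT) and `BeyondDiagonalBeatsQuarter` remain hypotheses, and
the two printed facts remain named facts of the Literature (fact debt unchanged). Standard axioms only.
«The programme SEARCHES and TYPES; no claim about Landau–Siegel zeros, Theorems 1–2 of
arXiv:2211.02515 or a repaired Margin232 until a kernel theorem says so.»
-/

namespace Summit.Parity.GeneralizedHardyLittlewood.Theses.PrimeLevelFamEdge

open Literature.NumberTheory.LFunctions

/-- **Aside item `EdgeOfBeyondDiagonalValue` (stmt-Parity-20436) holds**: under Lapid–Rallis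
non-negativity and the Kowalski–Michel Petersson bound (gcd form), KMV moment asymptotics on a window
`(1, Δ]` beyond the diagonal plus an admissible profile of Cauchy–Schwarz value `> 1/4` on an initial
segment `(1, b)` of lengths give `FamEdgeWeightTwo`. Proof: the tree theorem
`CentralValueFamilyHalfEdge.primeLevelFamilyTwo_EStarFam_of_beyondDiagonalValue_pb` (p533413), whose
statement is the item's body with `FamEdgeWeightTwo` unfolded. -/
theorem edgeOfBeyondDiagonalValue_holds : EdgeOfBeyondDiagonalValue :=
  fun hLR hP => CentralValueFamilyHalfEdge.primeLevelFamilyTwo_EStarFam_of_beyondDiagonalValue_pb hLR hP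

end Summit.Parity.GeneralizedHardyLittlewood.Theses.PrimeLevelFamEdge
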